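import Summits.Schanuel.Schanuel.Theorems.ZilberEacDegenerateDirectionRows
import Summits.Schanuel.Schanuel.Theorems.ZilberEacFibreMinimalPolynomial
import HarnessLib

/-!
# The exponential-polynomial regime, CXIV (a): the PUISEUX ROOT OF A FIBRE CURVE ALONG A PLACE
# WITHOUT the discriminant hypothesis

HONEST FRAMING.  Cell `pub-schanuel` (Zilber's Exponential-Algebraic Closedness, case ladder;
host summit Schanuel), seat 2, gen 34.  File XCII (`exists_fibreCurve_puiseuxRoot`) produces a
Puiseux root `ψ(σ)σ^L` of `P(x₀(s), x₁(s); y) = 0` along a place of the base curve `F = 0` under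
THREE hypotheses on `P ∈ ℂ[x₀][x₁][y]`: `F ∤` top coefficient, `F ∤ P(0)`, and `F ∤ Res_y(P, ∂_yP)`
(separability modulo `F`).  The last one is inconvenient for the degenerate parts `G|_{y₁ = 0}` of
file CX (they may be inseparable, e.g. `(y₀ − 1)² + y₁`).  **`exists_fibreCurve_puiseuxRoot_general`**
removes it: take a root `β ≠ 0` of `P` in an algebraic closure `L` of the function field
`K = Frac(ℂ[x₀][x₁]/(F))` (XCV `exists_functionField_of_irreducible`), let
`ι : ℂ[x₀][x₁][y] → L` be evaluation at `β`, and apply XCV's `exists_fibreMinimalPolynomial` with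
the prime `⊥ ⊂ L`: it yields a SEPARABLE nondegenerate `Q ∈ ker ι` with the division property
`lc(Q)^k P = A Q + H`, `F ∣ H`; XCII gives a Puiseux root of `Q`, which is a root of `P` along the
place because `lc(Q)(x(s)) ≠ 0` there.  [folklore algebra]; nothing here bears on Mantova–Masser's
question (OPEN), EC(3,2) (OPEN) or Schanuel's conjecture (neither used nor implied); EAC ⇏ SC.
-/

noncomputable section

open Filter Topology Polynomial

set_option linter.dupNamespace false

namespace Summit.Schanuel.Schanuel.Theorems

section FibreCurvePuiseuxGeneral

variable (F : ℂ[X][X])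

/-- A polynomial all of whose coefficients are divisible by `F` vanishes identically along a place
of `F = 0`. [folklore] -/
theorem eval_map_eq_zero_of_forall_dvd {H : Polynomial ℂ[X][X]} (hH : ∀ j, F ∣ H.coeff j)
    (f : ℂ[X][X] →+* ℂ) (hf : f F = 0) (y : ℂ) : (H.map f).eval y = 0 := by
  have h0 : H.map f = 0 := by
    ext j
    rw [Polynomial.coeff_map, Polynomial.coeff_zero]
    obtain ⟨c, hc⟩ := hH j
    rw [hc, map_mul, hf, zero_mul]
  rw [h0, Polynomial.eval_zero]

/-- **Puiseux root of a fibre curve along a place, general form (no discriminant hypothesis).**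
`F` irreducible of positive `x₁`-degree; a place `x₀ = s^{-k}`, `x₁ = Φ(s)s^{-M}`;
`P ∈ ℂ[x₀][x₁][y]` of positive degree with `F ∤` (top coefficient) and `F ∤ P(0)`.  Then there are
`e ≥ 1`, `L ∈ ℤ`, `ψ` analytic at `0` with `ψ(0) ≠ 0`, and `P(x₀(σ^e), x₁(σ^e); ψ(σ)σ^L) = 0`
for all small `σ ≠ 0`. [folklore (Newton–Puiseux)] (new in this form) -/
theorem exists_fibreCurve_puiseuxRoot_general (hFirr : Irreducible F) (hn : 1 ≤ F.natDegree)
    {k : ℕ} (hk : 1 ≤ k) (M : ℕ) {Φ : ℂ → ℂ} (hΦan : AnalyticAt ℂ Φ 0)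
    (hplace : ∀ᶠ s in 𝓝[≠] (0 : ℂ),
      (F.map (Polynomial.evalRingHom (s ^ k)⁻¹)).eval (Φ s * (s ^ M)⁻¹) = 0)
    (P : Polynomial ℂ[X][X]) (hd : 1 ≤ P.natDegree) (htop : ¬ F ∣ P.leadingCoeff)
    (hbot : ¬ F ∣ P.coeff 0) :
    ∃ (e : ℕ) (L : ℤ) (ψ : ℂ → ℂ), 1 ≤ e ∧ AnalyticAt ℂ ψ 0 ∧ ψ 0 ≠ 0 ∧
      ∀ᶠ σ in 𝓝[≠] (0 : ℂ),
        (P.map (Polynomial.eval₂RingHom (Polynomial.evalRingHom ((σ ^ e) ^ k)⁻¹)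
          (Φ (σ ^ e) * ((σ ^ e) ^ M)⁻¹))).eval (ψ σ * σ ^ L) = 0 := by
  classical
  -- the function field `K` and an algebraic closure `Lc`
  obtain ⟨K, instK, instCZ, φ, hφ, hfrac⟩ := exists_functionField_of_irreducible hFirr
  letI : Field K := instK
  letI : CharZero K := instCZ
  let Lc : Type := AlgebraicClosure K
  have hinj : Function.Injective (algebraMap K Lc) := (algebraMap K Lc).injective
  set f : ℂ[X][X] →+* Lc := (algebraMap K Lc).comp φ with hfdef
  have hf0 : ∀ G : ℂ[X][X], f G = 0 ↔ F ∣ G := by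
    intro G
    rw [hfdef, RingHom.comp_apply, map_eq_zero_iff _ hinj, hφ]
  -- a nonzero root `β` of `P` in `Lc`
  set g : Polynomial Lc := P.map f with hg
  have hlc : f P.leadingCoeff ≠ 0 := fun h => htop ((hf0 _).1 h)
  have hgdeg : g.natDegree = P.natDegree := Polynomial.natDegree_map_of_leadingCoeff_ne_zero f hlc
  have hgdeg' : g.degree ≠ 0 := by
    intro h
    have h1 := Polynomial.natDegree_eq_zero_iff_degree_le_zero.2 h.le
    rw [hgdeg] at h1
    omega
  obtain ⟨β, hβ⟩ := IsAlgClosed.exists_root g hgdeg'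
  have hβ0 : β ≠ 0 := by
    intro h0
    rw [h0, Polynomial.IsRoot, ← Polynomial.coeff_zero_eq_eval_zero, hg, Polynomial.coeff_map] at hβ
    exact hbot ((hf0 _).1 hβ)
  -- evaluation at `β`, and XCV with the prime `⊥`
  set ι : Polynomial ℂ[X][X] →+* Lc := Polynomial.eval₂RingHom f β with hι
  have hιev : ∀ G : Polynomial ℂ[X][X], ι G = (G.map f).eval β := by
    intro G
    rw [hι, Polynomial.coe_eval₂RingHom, Polynomial.eval_map]
  haveI : (⊥ : Ideal Lc).IsPrime := Ideal.isPrime_bot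
  have hF' : ι (Polynomial.C F) ∈ (⊥ : Ideal Lc) := by
    rw [Ideal.mem_bot, hι, Polynomial.coe_eval₂RingHom, Polynomial.eval₂_C, hf0]
  have hconst : ∀ G : ℂ[X][X], ι (Polynomial.C G) ∈ (⊥ : Ideal Lc) → F ∣ G := by
    intro G h
    rw [Ideal.mem_bot, hι, Polynomial.coe_eval₂RingHom, Polynomial.eval₂_C, hf0] at h
    exact h
  have hX : ι Polynomial.X ∉ (⊥ : Ideal Lc) := by
    rw [Ideal.mem_bot, hι, Polynomial.coe_eval₂RingHom, Polynomial.eval₂_X]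
    exact hβ0
  have hP₀ : ι P ∈ (⊥ : Ideal Lc) := by
    rw [Ideal.mem_bot, hιev]
    exact hβ
  obtain ⟨Q₀, hQ₀mem, hQ₀d, hQ₀top, hQ₀bot, hQ₀disc, hdiv⟩ :=
    exists_fibreMinimalPolynomial (𝔭 := (⊥ : Ideal Lc)) (ι := ι) hFirr hF' hconst hX hP₀
      ⟨P.natDegree, htop⟩
  -- the Puiseux root of the minimal polynomial (file XCII)
  obtain ⟨e, L', ψ, he, hψan, hψ0, hroot⟩ :=
    exists_fibreCurve_puiseuxRoot F hFirr hn hk M hΦan hplace Q₀ hQ₀d hQ₀top hQ₀bot hQ₀disc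
  -- the division `C lc^k' · P = A · Q₀ + H`, `F ∣ H`
  obtain ⟨k', A, H, hdivP, hH⟩ := hdiv P hP₀
  -- along the place: `lc(Q₀) ≠ 0`, `F = 0`
  have hpow := tendsto_pow_puncturedNhds_zero e he
  have hplaceσ : ∀ᶠ σ in 𝓝[≠] (0 : ℂ),
      (F.map (Polynomial.evalRingHom ((σ ^ e) ^ k)⁻¹)).eval (Φ (σ ^ e) * ((σ ^ e) ^ M)⁻¹) = 0 :=
    hpow.eventually hplace
  obtain ⟨φl, Ll, hφlan, hφl0, hφlev⟩ :=
    exists_row_along_place F hFirr hn hk M hΦan hplace Q₀.leadingCoeff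
  have hlcne : ∀ᶠ σ in 𝓝[≠] (0 : ℂ),
      (Q₀.leadingCoeff.map (Polynomial.evalRingHom ((σ ^ e) ^ k)⁻¹)).eval
        (Φ (σ ^ e) * ((σ ^ e) ^ M)⁻¹) ≠ 0 := by
    have h1 : ∀ᶠ s in 𝓝[≠] (0 : ℂ), φl s ≠ 0 :=
      nhdsWithin_le_nhds (hφlan.continuousAt.eventually_ne (hφl0 hQ₀top))
    filter_upwards [hpow.eventually hφlev, hpow.eventually h1, self_mem_nhdsWithin] with σ hσ h1σ hσ0
    rw [hσ]
    exact mul_ne_zero h1σ (zpow_ne_zero _ (pow_ne_zero _ hσ0))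
  refine ⟨e, L', ψ, he, hψan, hψ0, ?_⟩
  filter_upwards [hroot, hlcne, hplaceσ] with σ hr hl hFσ
  set ev : ℂ[X][X] →+* ℂ := Polynomial.eval₂RingHom (Polynomial.evalRingHom ((σ ^ e) ^ k)⁻¹)
    (Φ (σ ^ e) * ((σ ^ e) ^ M)⁻¹) with hev
  have hevF : ∀ G : ℂ[X][X], ev G =
      (G.map (Polynomial.evalRingHom ((σ ^ e) ^ k)⁻¹)).eval (Φ (σ ^ e) * ((σ ^ e) ^ M)⁻¹) := by
    intro G
    rw [hev]
    simp only [Polynomial.coe_eval₂RingHom, Polynomial.eval_map]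
  have hFσ' : ev F = 0 := by rw [hevF]; exact hFσ
  have hHz : (H.map ev).eval (ψ σ * σ ^ L') = 0 := eval_map_eq_zero_of_forall_dvd F hH ev hFσ' _
  have hlc' : ev Q₀.leadingCoeff ≠ 0 := by rw [hevF]; exact hl
  have key := congrArg (fun T : Polynomial ℂ[X][X] => (T.map ev).eval (ψ σ * σ ^ L')) hdivP
  simp only [Polynomial.map_mul, Polynomial.map_pow, Polynomial.map_C, Polynomial.eval_mul,
    Polynomial.eval_pow, Polynomial.eval_C, Polynomial.map_add, Polynomial.eval_add, hr, mul_zero,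
    zero_add, hHz] at key
  exact (mul_eq_zero.1 key).resolve_left (pow_ne_zero _ hlc')

end FibreCurvePuiseuxGeneral

end Summit.Schanuel.Schanuel.Theorems

end
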